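import Summits.Parity.GeneralizedHardyLittlewood.Theses.MaynardProductExact
import Literature.NumberTheory.Sieve.PolymathProdRadialCertL3

/-!
# Route `MaynardProductExact`, support item `FourLtPolymathFiftyOne` (stmt-Parity-23159): `M_{51,1/25} > 4`

Closed by name by the tree's kernel-pure rank-four product-radial certificate
`Literature.NumberTheory.Sieve.PolymathCert.exists_polymathFunctional_51_gt_four` (`PolymathProdRadialCertL3.lean`).
-/

namespace Summit.Parity.GeneralizedHardyLittlewood.Theses.MaynardProductExact

/-- **`FourLtPolymathFiftyOne` holds**: there are `ε ∈ (0,1)` and a Polymath test function `F` on `R_51` with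
`polymathFunctional 51 ε F > 4` (the certificate has `ε = 1/25`). -/
theorem fourLtPolymathFiftyOne_holds : FourLtPolymathFiftyOne :=
  Literature.NumberTheory.Sieve.PolymathCert.exists_polymathFunctional_51_gt_four

end Summit.Parity.GeneralizedHardyLittlewood.Theses.MaynardProductExact
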